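import Literature.AlgebraicGeometry.Resolution.AdicCompletionRegular
import Mathlib.RingTheory.AdjoinRoot
import HarnessLib

/-!
# Crux `Steer` (stmt-ResolutionOfSingularities-16345), chain W4.1: the isolatedness clause of a `p`-radicand ring under UNIT RESCALING of the radicand
# (light-import copy for the Lemma S kernel)

OURS (campaign `res-hironaka`, rung L ★L-G4, slot W4.1; seat res-L0-w41-stub-2 g6). Theses-free, definition-free, imports `Literature.…AdicCompletionRegular` +
Mathlib only. The two statements below are the `w = 0` case of `RadicandRenorm.isolated_renorm` / `StrippedThread.isolated_rescale` (res-D-pv-011,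
`…StrippedThreadGerm`), re-derived here with LIGHT imports so that the Lemma S kernel `…NoSatelliteStep` does not depend on the stripped-thread /
local-uniformisation import chain. [folklore]

* `RadicandRescale.nonempty_algEquiv_unit_pow_mul` — `S[T]/(T^p − f) ≃ₐ S[T]/(T^p − f′)` for `f′ = u^p f`, `u` a unit;
* `RadicandRescale.isolated_unit_pow_mul` — hence the isolatedness clause passes from `f` to `u^(p e) · f` for a unit `u`.
-/

noncomputable section

set_option linter.dupNamespace false

open Polynomial IsLocalRing Literature.AlgebraicGeometry.Resolution

namespace Summit.ResolutionOfSingularities.ResolutionOfSingularities.Theorems.SwitchingDichotomy.RadicandRescale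

universe v

/-- **`S[T]/(T^p − f) ≃ S[T]/(T^p − f′)` as `S`-algebras when `f′ = u^p·f` for a unit `u`** (`T ↦ u·T`, inverse `T ↦ u⁻¹·T`). [folklore] -/
theorem nonempty_algEquiv_unit_pow_mul {S : Type v} [CommRing S] (p : ℕ) {u f f' : S} (hu : IsUnit u) (hf' : f' = u ^ p * f) :
    Nonempty (AdjoinRoot (X ^ p - C f : S[X]) ≃ₐ[S] AdjoinRoot (X ^ p - C f' : S[X])) := by
  -- adapted from Theorems/FrobeniusClosingSteerStrippedThreadGerm.lean (`StrippedThread.isolated_rescale`, res-D-pv-011)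
  obtain ⟨v, hv⟩ := hu.exists_left_inv
  set F : S[X] := X ^ p - C f with hF
  set F' : S[X] := X ^ p - C f' with hF'
  have hrootF : AdjoinRoot.mk F (X ^ p) = AdjoinRoot.of F f := by
    have h0 : AdjoinRoot.mk F (X ^ p - C f) = 0 := by rw [← hF]; exact AdjoinRoot.mk_self
    rw [map_sub, sub_eq_zero, AdjoinRoot.mk_C] at h0
    exact h0
  have hrootF' : AdjoinRoot.mk F' (X ^ p) = AdjoinRoot.of F' f' := by
    have h0 : AdjoinRoot.mk F' (X ^ p - C f') = 0 := by rw [← hF']; exact AdjoinRoot.mk_self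
    rw [map_sub, sub_eq_zero, AdjoinRoot.mk_C] at h0
    exact h0
  set a : AdjoinRoot F := AdjoinRoot.mk F (C u * X) with ha
  set b : AdjoinRoot F' := AdjoinRoot.mk F' (C v * X) with hb
  have hapow : a ^ p = AdjoinRoot.of F f' := by
    rw [ha, ← map_pow, mul_pow, ← C_pow, map_mul, AdjoinRoot.mk_C, hrootF, hf', map_mul, map_pow]
  have hbpow : b ^ p = AdjoinRoot.of F' f := by
    rw [hb, ← map_pow, mul_pow, ← C_pow, map_mul, AdjoinRoot.mk_C, hrootF', hf']
    simp only [map_mul, map_pow]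
    have hvu : AdjoinRoot.of F' v ^ p * AdjoinRoot.of F' u ^ p = 1 := by
      rw [← mul_pow, ← map_mul, hv, map_one, one_pow]
    linear_combination (AdjoinRoot.of F' f) * hvu
  have haev : F'.eval₂ (algebraMap S (AdjoinRoot F)) a = 0 := by
    rw [hF', eval₂_sub, eval₂_X_pow, eval₂_C, hapow, AdjoinRoot.algebraMap_eq, sub_self]
  have hbev : F.eval₂ (algebraMap S (AdjoinRoot F')) b = 0 := by
    rw [hF, eval₂_sub, eval₂_X_pow, eval₂_C, hbpow, AdjoinRoot.algebraMap_eq, sub_self]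
  let φ : AdjoinRoot F' →ₐ[S] AdjoinRoot F := AdjoinRoot.liftAlgHom F' (Algebra.ofId S _) a haev
  let ψ : AdjoinRoot F →ₐ[S] AdjoinRoot F' := AdjoinRoot.liftAlgHom F (Algebra.ofId S _) b hbev
  have hφroot : φ (AdjoinRoot.root F') = a := AdjoinRoot.liftAlgHom_root _ _ _ _
  have hψroot : ψ (AdjoinRoot.root F) = b := AdjoinRoot.liftAlgHom_root _ _ _ _
  have hφof : ∀ r : S, φ (AdjoinRoot.of F' r) = AdjoinRoot.of F r := fun r => AdjoinRoot.liftAlgHom_of _ _ _ _ r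
  have hψof : ∀ r : S, ψ (AdjoinRoot.of F r) = AdjoinRoot.of F' r := fun r => AdjoinRoot.liftAlgHom_of _ _ _ _ r
  have ha' : a = AdjoinRoot.of F u * AdjoinRoot.root F := by
    rw [ha, map_mul, AdjoinRoot.mk_C, AdjoinRoot.mk_X]
  have hb' : b = AdjoinRoot.of F' v * AdjoinRoot.root F' := by
    rw [hb, map_mul, AdjoinRoot.mk_C, AdjoinRoot.mk_X]
  have hφψ : φ.comp ψ = AlgHom.id S _ := by
    refine AdjoinRoot.algHom_ext ?_
    rw [AlgHom.comp_apply, AlgHom.id_apply, hψroot, hb', map_mul, hφof, hφroot, ha']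
    have : AdjoinRoot.of F v * AdjoinRoot.of F u = 1 := by rw [← map_mul, hv, map_one]
    linear_combination (AdjoinRoot.root F) * this
  have hψφ : ψ.comp φ = AlgHom.id S _ := by
    refine AdjoinRoot.algHom_ext ?_
    rw [AlgHom.comp_apply, AlgHom.id_apply, hφroot, ha', map_mul, hψof, hψroot, hb']
    have : AdjoinRoot.of F' u * AdjoinRoot.of F' v = 1 := by rw [← map_mul, mul_comm, hv, map_one]
    linear_combination (AdjoinRoot.root F') * this
  exact ⟨AlgEquiv.ofAlgHom ψ φ hψφ hφψ⟩

/-- **The isolatedness clause of `S[T]/(T^p − f)` passes to `S[T]/(T^p − u^(p·e)·f)` for a unit `u`**: transport of «every non-maximal prime localises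
to a regular local ring» along the isomorphism of `nonempty_algEquiv_unit_pow_mul` (with `w = u^e`). [folklore] -/
theorem isolated_unit_pow_mul {S : Type v} [CommRing S] (p e : ℕ) {u f : S} (hu : IsUnit u)
    (h : ∀ (P : Ideal (AdjoinRoot (X ^ p - C f : S[X]))) [P.IsPrime],
      (∃ Q : Ideal (AdjoinRoot (X ^ p - C f : S[X])), Q.IsPrime ∧ P < Q) → IsRegularLocalRing (Localization.AtPrime P)) :
    ∀ (P' : Ideal (AdjoinRoot (X ^ p - C (u ^ (p * e) * f) : S[X]))) [P'.IsPrime],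
      (∃ Q' : Ideal (AdjoinRoot (X ^ p - C (u ^ (p * e) * f) : S[X])), Q'.IsPrime ∧ P' < Q') →
        IsRegularLocalRing (Localization.AtPrime P') := by
  -- adapted from Theorems/FrobeniusClosingSteerStrippedThreadGerm.lean (`StrippedThread.isolated_of_ringEquiv`, res-D-pv-011)
  obtain ⟨eqa⟩ := nonempty_algEquiv_unit_pow_mul p (f := f) (f' := u ^ (p * e) * f) (hu.pow e) (by rw [← pow_mul, mul_comm e p])
  set e' : AdjoinRoot (X ^ p - C f : S[X]) ≃+* AdjoinRoot (X ^ p - C (u ^ (p * e) * f) : S[X]) := eqa.toRingEquiv with he'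
  intro P' hP' hQ'
  obtain ⟨Q', hQ'p, hlt⟩ := hQ'
  set P : Ideal (AdjoinRoot (X ^ p - C f : S[X])) := P'.comap (e' : AdjoinRoot (X ^ p - C f : S[X]) →+* _) with hPdef
  haveI : P.IsPrime := Ideal.comap_isPrime _ _
  have hQ : ∃ Q : Ideal (AdjoinRoot (X ^ p - C f : S[X])), Q.IsPrime ∧ P < Q := by
    refine ⟨Q'.comap (e' : AdjoinRoot (X ^ p - C f : S[X]) →+* _), Ideal.comap_isPrime _ _, ?_⟩
    refine lt_of_le_of_ne (Ideal.comap_mono hlt.le) fun heq => hlt.ne ?_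
    exact Ideal.comap_injective_of_surjective (e' : AdjoinRoot (X ^ p - C f : S[X]) →+* _) e'.surjective heq
  haveI hreg := h P hQ
  have hM : P.primeCompl.map e'.toMonoidHom = P'.primeCompl := by
    ext y
    constructor
    · rintro ⟨z, hz, rfl⟩
      exact fun hy => hz (show z ∈ P from hy)
    · intro hy
      refine ⟨e'.symm y, fun hz => hy ?_, e'.apply_symm_apply y⟩
      have : e' (e'.symm y) ∈ P' := hz
      rwa [e'.apply_symm_apply] at this
  exact IsRegularLocalRing.of_ringEquiv (IsLocalization.ringEquivOfRingEquiv (Localization.AtPrime P) (Localization.AtPrime P') e' hM)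

end Summit.ResolutionOfSingularities.ResolutionOfSingularities.Theorems.SwitchingDichotomy.RadicandRescale

end
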